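import Mathlib

/-!
# Route `ParabolicTrajectory`, crux `ContinuumLimitOnTrajectory` (stmt-QuantumFields-10522), line `jacobian-collapse-gronwall`: stub `stub_levelSetTransport` — level-set charts (helper file 1 of 2)

Pure real analysis over Mathlib for the level-set transport stub `LevelSetTransport` of the vocabulary file
`…JCGDefs` (no lattice object and none of the route's vocabulary is used here, so that this file stands on
Mathlib alone):

* §1 slices of, and curves through, a function of two real variables whose uncurrying is differentiable
  (`hasDerivAt_uncurry_along`, `hasDerivAt_slice_fst/snd`), differentiability from `C²` on `{D > 0}`;
* §2 the logarithmic mean-value bound `|φ b - φ a| ≤ c log (b/a)` from `|x φ'| ≤ c`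
  (`abs_sub_le_mul_log_div`, Cauchy's mean value theorem against `log`);
* §3 the LOCAL LEVEL-SET CHART of a `C²` function `N` at a point where `∂_β N ≠ 0` (`levelSet_localChart`:
  Mathlib's implicit function theorem `ContDiffAt.implicitFunction`, packaged with a box on which `∂_β N`
  keeps its sign and the `β`-slices of `σ N` are strictly monotone, and the implicit derivative
  `ψ' = -∂_D N / ∂_β N` obtained by differentiating the level identity);
* §4 LOCAL TRANSPORT along such a chart inside the scaling window (`levelSet_localTransport`): ascent
  (monotonicity of the chart, by comparing `N` along horizontal segments of the window, where
  `D ∂_D N ∂_β N ≤ 0`), the slope bound `Δβ ≤ K log (D/Da)` and the transport bounds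
  `|Δ X i| ≤ η i log (D/Da)` (`|dX i/d log D| = |jac| / |∂_β N| ≤ η i`).

The continuation argument across a whole decade and the stub itself are in `…JCGStubLevelSetTransport`.
Refs: line card `Lines/jacobian-collapse-gronwall.md` (stub B); Lüscher–Weisz–Wolff step scaling (the level
sets of the tuning observable are the lines of constant physics).
-/

set_option autoImplicit false

open Set Filter Topology

namespace Summit.QuantumFields.YangMills.Cruxes.ContinuumLimitOnTrajectory.JacobianCollapseGronwall

/-! ### §1 Slices of, and curves through, a differentiable function of two real variables -/

/-- Chain rule along a plane curve `s ↦ (γ₁ s, γ₂ s)` through `p` for a curried `F : ℝ → ℝ → ℝ` whose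
uncurrying is differentiable at `p`: the derivative is `γ₁' ∂₁F + γ₂' ∂₂F`, the partials being the Fréchet
derivative on the coordinate vectors. -/
theorem hasDerivAt_uncurry_along {F : ℝ → ℝ → ℝ} {p : ℝ × ℝ}
    (hF : DifferentiableAt ℝ (Function.uncurry F) p) {γ₁ γ₂ : ℝ → ℝ} {a b t : ℝ}
    (h₁ : HasDerivAt γ₁ a t) (h₂ : HasDerivAt γ₂ b t) (hp : (γ₁ t, γ₂ t) = p) :
    HasDerivAt (fun s => F (γ₁ s) (γ₂ s))
      (a * fderiv ℝ (Function.uncurry F) p (1, 0) + b * fderiv ℝ (Function.uncurry F) p (0, 1)) t := by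
  subst hp
  have h := hF.hasFDerivAt.comp_hasDerivAt t (h₁.prodMk h₂)
  have key : fderiv ℝ (Function.uncurry F) (γ₁ t, γ₂ t) (a, b) =
      a * fderiv ℝ (Function.uncurry F) (γ₁ t, γ₂ t) (1, 0) +
        b * fderiv ℝ (Function.uncurry F) (γ₁ t, γ₂ t) (0, 1) := by
    have hab : ((a, b) : ℝ × ℝ) = a • ((1 : ℝ), (0 : ℝ)) + b • ((0 : ℝ), (1 : ℝ)) := by simp
    rw [hab, map_add, map_smul, map_smul, smul_eq_mul, smul_eq_mul]
  rw [← key]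
  exact h

/-- The slice `D ↦ F D b` has derivative `∂₁F (D, b)`. -/
theorem hasDerivAt_slice_fst {F : ℝ → ℝ → ℝ} {D b : ℝ}
    (hF : DifferentiableAt ℝ (Function.uncurry F) (D, b)) :
    HasDerivAt (fun D' => F D' b) (fderiv ℝ (Function.uncurry F) (D, b) (1, 0)) D := by
  simpa using hasDerivAt_uncurry_along hF (hasDerivAt_id' D) (hasDerivAt_const D b) rfl

/-- The slice `b ↦ F D b` has derivative `∂₂F (D, b)`. -/
theorem hasDerivAt_slice_snd {F : ℝ → ℝ → ℝ} {D b : ℝ}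
    (hF : DifferentiableAt ℝ (Function.uncurry F) (D, b)) :
    HasDerivAt (F D) (fderiv ℝ (Function.uncurry F) (D, b) (0, 1)) b := by
  simpa using hasDerivAt_uncurry_along hF (hasDerivAt_const b D) (hasDerivAt_id' b) rfl

/-- A function that is `C²` on the open half-plane `{D > 0}` is differentiable at each of its points. -/
theorem differentiableAt_of_contDiffOn_halfPlane {F : ℝ → ℝ → ℝ}
    (hF : ContDiffOn ℝ 2 (Function.uncurry F) (Set.Ioi (0 : ℝ) ×ˢ (Set.univ : Set ℝ))) {D : ℝ} (b : ℝ)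
    (hD : 0 < D) : DifferentiableAt ℝ (Function.uncurry F) (D, b) :=
  (hF.contDiffAt ((isOpen_Ioi.prod isOpen_univ).mem_nhds
    (show (D, b) ∈ Set.Ioi (0 : ℝ) ×ˢ (Set.univ : Set ℝ) from ⟨hD, Set.mem_univ b⟩))).differentiableAt
    (by simp)

/-! ### §2 The logarithmic mean-value estimate -/

/-- **Logarithmic mean-value bound.** If `φ` is continuous on `[a, b] ⊆ (0, ∞)` with `|x φ'(x)| ≤ c` on
`(a, b)`, then `|φ b - φ a| ≤ c log (b / a)` (Cauchy's mean value theorem against `log`). -/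
theorem abs_sub_le_mul_log_div {φ φ' : ℝ → ℝ} {a b c : ℝ} (ha : 0 < a) (hab : a ≤ b)
    (hcont : ContinuousOn φ (Set.Icc a b)) (hder : ∀ x ∈ Set.Ioo a b, HasDerivAt φ (φ' x) x)
    (hbound : ∀ x ∈ Set.Ioo a b, |x * φ' x| ≤ c) : |φ b - φ a| ≤ c * Real.log (b / a) := by
  rcases hab.eq_or_lt with rfl | hlt
  · simp
  obtain ⟨x, hx, h⟩ := exists_ratio_hasDerivAt_eq_ratio_slope φ φ' hlt hcont hder Real.log
    (fun y => y⁻¹) (Real.continuousOn_log.mono fun y hy => (ha.trans_le hy.1).ne')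
    (fun y hy => Real.hasDerivAt_log (ha.trans hy.1).ne')
  have hx0 : 0 < x := ha.trans hx.1
  have hlog : Real.log (b / a) = Real.log b - Real.log a := Real.log_div (ha.trans hlt).ne' ha.ne'
  have hlog0 : 0 ≤ Real.log b - Real.log a :=
    sub_nonneg.2 (Real.log_le_log ha hlt.le)
  have hkey : φ b - φ a = x * φ' x * (Real.log b - Real.log a) := by
    have hx' : x ≠ 0 := hx0.ne'
    calc φ b - φ a = x * ((φ b - φ a) * x⁻¹) := by field_simp
      _ = x * ((Real.log b - Real.log a) * φ' x) := by rw [h]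
      _ = x * φ' x * (Real.log b - Real.log a) := by ring
  rw [hkey, hlog, abs_mul, abs_of_nonneg hlog0]
  exact mul_le_mul_of_nonneg_right (hbound x hx) hlog0

/-! ### §3 The local level-set chart -/

/-- **Local level-set chart** (the implicit function theorem for a `C²` function of two real variables,
packaged for continuation arguments).  If `N` is `C²` on `{D > 0}`, `∂_β N (D₀, b₀) ≠ 0`, `D₀ > 0` and `U` is an
open neighbourhood of `(D₀, b₀)`, there are a box `(D₀ ± δ) × (b₀ ± ε) ⊆ U` (`δ ≤ D₀`) on which `∂_β N` has
the sign of `σ := ∂_β N (D₀, b₀)` and every `β`-slice of `σ N` is strictly increasing, and a function `ψ`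
on `(D₀ ± δ)` with values in `(b₀ ± ε)`, `ψ D₀ = b₀`, parametrising the level set `{N = N (D₀, b₀)}` there,
differentiable with the implicit derivative `ψ' = -∂_D N / ∂_β N`.  (Mathlib's `ContDiffAt.implicitFunction`
plus bookkeeping.) -/
theorem levelSet_localChart :
    ∀ (N : ℝ → ℝ → ℝ) (U : Set (ℝ × ℝ)) (D₀ b₀ : ℝ),
      ContDiffOn ℝ 2 (Function.uncurry N) (Set.Ioi (0 : ℝ) ×ˢ (Set.univ : Set ℝ)) →
      IsOpen U → (D₀, b₀) ∈ U → 0 < D₀ → deriv (N D₀) b₀ ≠ 0 →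
      ∃ (ψ : ℝ → ℝ) (δ ε : ℝ), 0 < δ ∧ 0 < ε ∧ δ ≤ D₀ ∧ ψ D₀ = b₀ ∧
        Set.Ioo (D₀ - δ) (D₀ + δ) ×ˢ Set.Ioo (b₀ - ε) (b₀ + ε) ⊆ U ∧
        (∀ D ∈ Set.Ioo (D₀ - δ) (D₀ + δ), ∀ b ∈ Set.Ioo (b₀ - ε) (b₀ + ε),
            0 < deriv (N D₀) b₀ * deriv (N D) b) ∧
        (∀ D ∈ Set.Ioo (D₀ - δ) (D₀ + δ),
            StrictMonoOn (fun b => deriv (N D₀) b₀ * N D b) (Set.Ioo (b₀ - ε) (b₀ + ε))) ∧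
        (∀ D ∈ Set.Ioo (D₀ - δ) (D₀ + δ), ψ D ∈ Set.Ioo (b₀ - ε) (b₀ + ε) ∧ N D (ψ D) = N D₀ b₀ ∧
            HasDerivAt ψ (-deriv (fun D' => N D' (ψ D)) D / deriv (N D) (ψ D)) D) := by
  intro N U D₀ b₀ hN hU hu hD₀ hN₂
  -- the uncurried function and its regularity
  set F : ℝ × ℝ → ℝ := Function.uncurry N with hFdef
  have hO : IsOpen (Set.Ioi (0 : ℝ) ×ˢ (Set.univ : Set ℝ)) := isOpen_Ioi.prod isOpen_univ
  have hmem : ∀ {D : ℝ} (b : ℝ), 0 < D → Set.Ioi (0 : ℝ) ×ˢ (Set.univ : Set ℝ) ∈ 𝓝 (D, b) :=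
    fun b hD => hO.mem_nhds ⟨hD, Set.mem_univ b⟩
  have hcd : ContDiffAt ℝ 2 F (D₀, b₀) := hN.contDiffAt (hmem b₀ hD₀)
  have hslice : ∀ {D : ℝ} (b : ℝ), 0 < D → HasDerivAt (N D) (fderiv ℝ F (D, b) (0, 1)) b :=
    fun b hD => hasDerivAt_slice_snd (differentiableAt_of_contDiffOn_halfPlane hN b hD)
  set σ : ℝ := deriv (N D₀) b₀ with hσdef
  have hσ : σ = fderiv ℝ F (D₀, b₀) (0, 1) := (hslice b₀ hD₀).deriv
  have hlin : ∀ y : ℝ, fderiv ℝ F (D₀, b₀) (0, y) = y * σ := by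
    intro y
    have : ((0 : ℝ), y) = y • ((0 : ℝ), (1 : ℝ)) := by simp
    rw [this, map_smul, smul_eq_mul, hσ]
  -- invertibility of the partial derivative in `β`
  have hinv : (fderiv ℝ F (D₀, b₀) ∘L ContinuousLinearMap.inr ℝ ℝ ℝ).IsInvertible := by
    refine ContinuousLinearMap.IsInvertible.of_inverse (g := σ⁻¹ • ContinuousLinearMap.id ℝ ℝ) ?_ ?_
    · ext
      simp [hlin, hN₂]
    · ext
      simp [hlin, hN₂]
  -- Mathlib's implicit function
  have h2 : (2 : WithTop ℕ∞) ≠ 0 := by simp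
  set ψ : ℝ → ℝ := hcd.implicitFunction h2 hinv with hψdef
  have hψ₀ : ψ D₀ = b₀ := hcd.implicitFunction_apply_self h2 hinv
  have hlev : ∀ᶠ D in 𝓝 D₀, F (D, ψ D) = F (D₀, b₀) := hcd.eventually_apply_implicitFunction h2 hinv
  have hψcd : ∀ᶠ D in 𝓝 D₀, ContDiffAt ℝ 2 ψ D :=
    (hcd.contDiffAt_implicitFunction h2 hinv).eventually (by simp)
  have hψcont : ContinuousAt ψ D₀ := (hcd.contDiffAt_implicitFunction h2 hinv).continuousAt
  -- a ball inside `U` on which `σ ∂_β N > 0`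
  have hcontf : ContinuousAt (fun p : ℝ × ℝ => σ * fderiv ℝ F p (0, 1)) (D₀, b₀) :=
    continuousAt_const.mul ((hcd.continuousAt_fderiv h2).clm_apply continuousAt_const)
  have hpos : ∀ᶠ p in 𝓝 (D₀, b₀), 0 < σ * fderiv ℝ F p (0, 1) := by
    refine hcontf.eventually_const_lt ?_
    show 0 < σ * fderiv ℝ F (D₀, b₀) (0, 1)
    rw [← hσ]
    exact mul_self_pos.2 hN₂
  obtain ⟨ε₁, hε₁, hball⟩ := Metric.eventually_nhds_iff_ball.mp ((hU.eventually_mem hu).and hpos)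
  set ε : ℝ := min ε₁ D₀ with hεdef
  have hε : 0 < ε := lt_min hε₁ hD₀
  have hεε₁ : ε ≤ ε₁ := min_le_left _ _
  have hεD₀ : ε ≤ D₀ := min_le_right _ _
  -- events in `D`
  have hψin : ∀ᶠ D in 𝓝 D₀, ψ D ∈ Set.Ioo (b₀ - ε) (b₀ + ε) := by
    refine hψcont.eventually_mem ?_
    rw [hψ₀]
    exact Ioo_mem_nhds (by linarith) (by linarith)
  obtain ⟨δ₁, hδ₁, hballD⟩ := Metric.eventually_nhds_iff_ball.mp (hlev.and (hψcd.and hψin))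
  set δ : ℝ := min δ₁ ε with hδdef
  have hδ : 0 < δ := lt_min hδ₁ hε
  have hδδ₁ : δ ≤ δ₁ := min_le_left _ _
  have hδε : δ ≤ ε := min_le_right _ _
  -- membership bookkeeping
  have hDball : ∀ {D : ℝ}, D ∈ Set.Ioo (D₀ - δ) (D₀ + δ) → D ∈ Metric.ball D₀ δ₁ := by
    intro D hD
    rw [Real.ball_eq_Ioo]
    exact ⟨by linarith [hD.1], by linarith [hD.2]⟩
  have hDpos : ∀ {D : ℝ}, D ∈ Set.Ioo (D₀ - δ) (D₀ + δ) → 0 < D := by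
    intro D hD
    linarith [hD.1]
  have hbox : ∀ {D b : ℝ}, D ∈ Set.Ioo (D₀ - δ) (D₀ + δ) → b ∈ Set.Ioo (b₀ - ε) (b₀ + ε) →
      (D, b) ∈ Metric.ball (D₀, b₀) ε₁ := by
    intro D b hD hb
    rw [← ball_prod_same, Set.mem_prod, Real.ball_eq_Ioo, Real.ball_eq_Ioo]
    exact ⟨⟨by linarith [hD.1], by linarith [hD.2]⟩, ⟨by linarith [hb.1], by linarith [hb.2]⟩⟩
  have hN₂eq : ∀ {D : ℝ} (b : ℝ), D ∈ Set.Ioo (D₀ - δ) (D₀ + δ) →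
      deriv (N D) b = fderiv ℝ F (D, b) (0, 1) := fun b hD => (hslice b (hDpos hD)).deriv
  have hsign : ∀ D ∈ Set.Ioo (D₀ - δ) (D₀ + δ), ∀ b ∈ Set.Ioo (b₀ - ε) (b₀ + ε),
      0 < σ * deriv (N D) b := by
    intro D hD b hb
    rw [hN₂eq b hD]
    exact (hball _ (hbox hD hb)).2
  refine ⟨ψ, δ, ε, hδ, hε, hδε.trans hεD₀, hψ₀, ?_, hsign, ?_, ?_⟩
  · -- the box lies in `U`
    rintro ⟨D, b⟩ ⟨hD, hb⟩
    exact (hball _ (hbox hD hb)).1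
  · -- strict monotonicity of the slices of `σ N`
    intro D hD
    refine strictMonoOn_of_deriv_pos (convex_Ioo _ _) ?_ ?_
    · exact fun b _ => (((hslice b (hDpos hD)).const_mul σ).continuousAt).continuousWithinAt
    · intro b hb
      rw [interior_Ioo] at hb
      rw [((hslice b (hDpos hD)).const_mul σ).deriv, ← hN₂eq b hD]
      exact hsign D hD b hb
  · -- the implicit function on `(D₀ ± δ)`
    intro D hD
    obtain ⟨hlevD, hcdD, hinD⟩ := hballD D (hDball hD)
    refine ⟨hinD, hlevD, ?_⟩
    have hD0 : 0 < D := hDpos hD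
    have hdiff : DifferentiableAt ℝ F (D, ψ D) := differentiableAt_of_contDiffOn_halfPlane hN (ψ D) hD0
    have hψd : HasDerivAt ψ (deriv ψ D) D := (hcdD.differentiableAt h2).hasDerivAt
    -- differentiate the identity `N (s, ψ s) = N (D₀, b₀)` near `D`
    have hchain := hasDerivAt_uncurry_along hdiff (hasDerivAt_id' D) hψd rfl
    have hconst : HasDerivAt (fun s => N s (ψ s)) 0 D := by
      refine (hasDerivAt_const D (F (D₀, b₀))).congr_of_eventuallyEq ?_
      filter_upwards [Metric.isOpen_ball.mem_nhds (hDball hD)] with s hs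
      exact (hballD s hs).1
    have hzero := hchain.unique hconst
    have h₁ : fderiv ℝ F (D, ψ D) (1, 0) = deriv (fun D' => N D' (ψ D)) D :=
      (hasDerivAt_slice_fst hdiff).deriv.symm
    have h₂ : fderiv ℝ F (D, ψ D) (0, 1) = deriv (N D) (ψ D) := (hN₂eq (ψ D) hD).symm
    have hne : deriv (N D) (ψ D) ≠ 0 := by
      have := hsign D hD (ψ D) hinD
      exact fun h => by simp [h] at this
    refine hψd.congr_deriv ?_
    rw [h₁, h₂, one_mul] at hzero
    field_simp
    linarith

/-! ### §4 Local transport along a chart inside the window -/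

/-- **Local transport along a level-set chart.**  In the setting of the continuation argument (window
`B ≤ β`, `N ∈ (θ₁, θ₂)`, `X i₀ ∈ (ρ₁, ρ₂)` over `D ∈ [D₁, D₂]`, with the collapse inequalities there), let
`ψ` be a level-set chart of `N` on the box `(D₀ ± δ) × (b₀ ± ε)` lying over the open part of the window
(as produced by `levelSet_localChart`).  If `D₁ ≤ Da ≤ Db ≤ D₂` lie in `(D₀ ± δ)` and `B ≤ ψ Da`, then on
`[Da, Db]` the chart is monotone (ASCENT, by comparison along horizontal segments, which lie in the window),
stays in the window, climbs by at most `K log (D / Da)` and moves every `X i` by at most `η i log (D / Da)`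
(logarithmic mean-value bound with `|d X i/d log D| = |jac| / |∂_β N| ≤ η i`). -/
theorem levelSet_localTransport :
    ∀ (ι : Type) (i₀ : ι) (X : ι → ℝ → ℝ → ℝ) (N : ℝ → ℝ → ℝ) (B θ₁ θ₂ ρ₁ ρ₂ D₁ D₂ K : ℝ) (η : ι → ℝ)
      (ψ : ℝ → ℝ) (D₀ b₀ δ ε Da Db : ℝ),
      ContDiffOn ℝ 2 (Function.uncurry N) (Set.Ioi (0 : ℝ) ×ˢ (Set.univ : Set ℝ)) →
      (∀ i, ContDiffOn ℝ 2 (Function.uncurry (X i)) (Set.Ioi (0 : ℝ) ×ˢ (Set.univ : Set ℝ))) →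
      (∀ (i : ι) (D b : ℝ), D ∈ Set.Icc D₁ D₂ → B ≤ b → N D b ∈ Set.Ioo θ₁ θ₂ →
          X i₀ D b ∈ Set.Ioo ρ₁ ρ₂ →
          deriv (N D) b ≠ 0 ∧ D * deriv (fun D' => N D' b) D * deriv (N D) b ≤ 0 ∧
            |D * deriv (fun D' => N D' b) D| ≤ K * |deriv (N D) b| ∧
            |D * deriv (fun D' => X i D' b) D * deriv (N D) b -
                D * deriv (fun D' => N D' b) D * deriv (X i D) b| ≤ η i * |deriv (N D) b|) →
      (∀ D ∈ Set.Ioo (D₀ - δ) (D₀ + δ), ∀ b ∈ Set.Ioo (b₀ - ε) (b₀ + ε),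
          0 < D ∧ N D b ∈ Set.Ioo θ₁ θ₂ ∧ X i₀ D b ∈ Set.Ioo ρ₁ ρ₂ ∧
            0 < deriv (N D₀) b₀ * deriv (N D) b) →
      (∀ D ∈ Set.Ioo (D₀ - δ) (D₀ + δ),
          StrictMonoOn (fun b => deriv (N D₀) b₀ * N D b) (Set.Ioo (b₀ - ε) (b₀ + ε))) →
      (∀ D ∈ Set.Ioo (D₀ - δ) (D₀ + δ), ψ D ∈ Set.Ioo (b₀ - ε) (b₀ + ε) ∧ N D (ψ D) = N D₀ b₀ ∧
          HasDerivAt ψ (-deriv (fun D' => N D' (ψ D)) D / deriv (N D) (ψ D)) D) →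
      Da ∈ Set.Ioo (D₀ - δ) (D₀ + δ) → Db ∈ Set.Ioo (D₀ - δ) (D₀ + δ) →
      D₁ ≤ Da → Da ≤ Db → Db ≤ D₂ → B ≤ ψ Da →
      MonotoneOn ψ (Set.Icc Da Db) ∧ ContinuousOn ψ (Set.Icc Da Db) ∧
        ∀ D ∈ Set.Icc Da Db, B ≤ ψ D ∧ ψ D - ψ Da ≤ K * Real.log (D / Da) ∧
          ∀ i, |X i D (ψ D) - X i Da (ψ Da)| ≤ η i * Real.log (D / Da) := by
  intro ι i₀ X N B θ₁ θ₂ ρ₁ ρ₂ D₁ D₂ K η ψ D₀ b₀ δ ε Da Db hN hX hW hbox hmono hψ hDa hDb h1a hab hb2 hBa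
  set σ : ℝ := deriv (N D₀) b₀ with hσdef
  have hI : ∀ {D : ℝ}, D ∈ Icc Da Db → D ∈ Ioo (D₀ - δ) (D₀ + δ) := fun hD =>
    ⟨hDa.1.trans_le hD.1, hD.2.trans_lt hDb.2⟩
  have hstrip : ∀ {D : ℝ}, D ∈ Icc Da Db → D ∈ Icc D₁ D₂ := fun hD =>
    ⟨h1a.trans hD.1, hD.2.trans hb2⟩
  have hcontψ : ∀ {D : ℝ}, D ∈ Ioo (D₀ - δ) (D₀ + δ) → ContinuousAt ψ D := fun hD =>
    (hψ _ hD).2.2.continuousAt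
  -- ASCENT: comparison along the horizontal segment at height `ψ D`
  have seg : ∀ D D' : ℝ, D ∈ Icc Da Db → D' ∈ Icc Da Db → D ≤ D' → B ≤ ψ D → ψ D ≤ ψ D' := by
    intro D D' hD hD' hle hBD
    set b : ℝ := ψ D with hbdef
    have hbJ : b ∈ Ioo (b₀ - ε) (b₀ + ε) := (hψ D (hI hD)).1
    have hIx : ∀ {x : ℝ}, x ∈ Icc D D' → x ∈ Ioo (D₀ - δ) (D₀ + δ) := fun hx =>
      hI ⟨hD.1.trans hx.1, hx.2.trans hD'.2⟩
    have hderx : ∀ {x : ℝ}, x ∈ Icc D D' →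
        HasDerivAt (fun x' => σ * N x' b) (σ * fderiv ℝ (Function.uncurry N) (x, b) (1, 0)) x :=
      fun hx => (hasDerivAt_slice_fst
        (differentiableAt_of_contDiffOn_halfPlane hN b (hbox _ (hIx hx) b hbJ).1)).const_mul σ
    have hanti : AntitoneOn (fun x' => σ * N x' b) (Icc D D') := by
      refine antitoneOn_of_deriv_nonpos (convex_Icc D D')
        (fun x hx => (hderx hx).continuousAt.continuousWithinAt)
        (fun x hx => (hderx (interior_subset hx)).differentiableAt.differentiableWithinAt) ?_
      intro x hx
      rw [interior_Icc] at hx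
      have hxI := hIx (Ioo_subset_Icc_self hx)
      obtain ⟨hx0, hxN, hxX, hxsign⟩ := hbox x hxI b hbJ
      rw [(hderx (Ioo_subset_Icc_self hx)).deriv,
        ← (hasDerivAt_slice_fst (differentiableAt_of_contDiffOn_halfPlane hN b hx0)).deriv]
      obtain ⟨-, hasc, -, -⟩ :=
        hW i₀ x b (hstrip ⟨hD.1.trans hx.1.le, hx.2.le.trans hD'.2⟩) hBD hxN hxX
      have hprod : deriv (fun D'' => N D'' b) x * deriv (N x) b ≤ 0 := by
        by_contra hcon
        push Not at hcon
        nlinarith [mul_pos hx0 hcon]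
      by_contra hcon
      push Not at hcon
      have e1 := mul_pos hcon hxsign
      have e2 : σ * σ * (deriv (fun D'' => N D'' b) x * deriv (N x) b) ≤ 0 :=
        mul_nonpos_of_nonneg_of_nonpos (mul_self_nonneg σ) hprod
      nlinarith [e1, e2]
    have h1 : σ * N D' b ≤ σ * N D b := hanti (left_mem_Icc.2 hle) (right_mem_Icc.2 hle) hle
    have h2 : N D b = N D₀ b₀ := (hψ D (hI hD)).2.1
    have h3 : N D' (ψ D') = N D₀ b₀ := (hψ D' (hI hD')).2.1
    have h4 : σ * N D' b ≤ σ * N D' (ψ D') := by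
      rw [h3, ← h2]
      exact h1
    exact ((hmono D' (hI hD')).le_iff_le hbJ (hψ D' (hI hD')).1).1 h4
  have hge : ∀ D ∈ Icc Da Db, ψ Da ≤ ψ D := fun D hD =>
    seg Da D (left_mem_Icc.2 hab) hD hD.1 hBa
  have hB : ∀ D ∈ Icc Da Db, B ≤ ψ D := fun D hD => hBa.trans (hge D hD)
  have hmonoψ : MonotoneOn ψ (Icc Da Db) := fun D hD D' hD' hle => seg D D' hD hD' hle (hB D hD)
  have hcontOn : ContinuousOn ψ (Icc Da Db) := fun D hD => (hcontψ (hI hD)).continuousWithinAt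
  have hDa0 : 0 < Da := (hbox Da hDa _ (hψ Da hDa).1).1
  refine ⟨hmonoψ, hcontOn, fun D hD => ⟨hB D hD, ?_, ?_⟩⟩
  · -- bounded slope: `|D ψ'| = |D ∂_D N| / |∂_β N| ≤ K`
    have key := abs_sub_le_mul_log_div (φ := ψ) (c := K)
      (φ' := fun x => -deriv (fun D' => N D' (ψ x)) x / deriv (N x) (ψ x)) hDa0 hD.1
      (hcontOn.mono (Icc_subset_Icc_right hD.2))
      (fun x hx => (hψ x (hI ⟨hx.1.le, hx.2.le.trans hD.2⟩)).2.2) ?_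
    · exact (le_abs_self _).trans key
    · intro x hx
      have hxab : x ∈ Icc Da Db := ⟨hx.1.le, hx.2.le.trans hD.2⟩
      have hxI := hI hxab
      obtain ⟨hx0, hxN, hxX, -⟩ := hbox x hxI (ψ x) (hψ x hxI).1
      obtain ⟨hne, -, hslope, -⟩ := hW i₀ x (ψ x) (hstrip hxab) (hB x hxab) hxN hxX
      rw [show x * (-deriv (fun D' => N D' (ψ x)) x / deriv (N x) (ψ x)) =
          -(x * deriv (fun D' => N D' (ψ x)) x) / deriv (N x) (ψ x) by ring,
        abs_div, abs_neg, div_le_iff₀ (abs_pos.2 hne)]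
      exact hslope
  · -- transport of `X i`: `|d X i/d log D| = |jac| / |∂_β N| ≤ η i`
    intro i
    have hXd : ∀ {x : ℝ}, x ∈ Icc Da Db →
        DifferentiableAt ℝ (Function.uncurry (X i)) (x, ψ x) := fun {x} hx =>
      differentiableAt_of_contDiffOn_halfPlane (hX i) (ψ x) (hbox x (hI hx) (ψ x) (hψ x (hI hx)).1).1
    have hder : ∀ {x : ℝ}, x ∈ Icc Da Db → HasDerivAt (fun s => X i s (ψ s))
        (1 * fderiv ℝ (Function.uncurry (X i)) (x, ψ x) (1, 0) +
          (-deriv (fun D' => N D' (ψ x)) x / deriv (N x) (ψ x)) *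
            fderiv ℝ (Function.uncurry (X i)) (x, ψ x) (0, 1)) x := fun {x} hx =>
      hasDerivAt_uncurry_along (hXd hx) (hasDerivAt_id' x) (hψ x (hI hx)).2.2 rfl
    refine abs_sub_le_mul_log_div hDa0 hD.1
      (fun x hx => (hder ⟨hx.1, hx.2.trans hD.2⟩).continuousAt.continuousWithinAt)
      (fun x hx => hder ⟨hx.1.le, hx.2.le.trans hD.2⟩) ?_
    intro x hx
    have hxab : x ∈ Icc Da Db := ⟨hx.1.le, hx.2.le.trans hD.2⟩
    have hxI := hI hxab
    obtain ⟨hx0, hxN, hxX, -⟩ := hbox x hxI (ψ x) (hψ x hxI).1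
    obtain ⟨hne, -, -, hjac⟩ := hW i x (ψ x) (hstrip hxab) (hB x hxab) hxN hxX
    rw [← (hasDerivAt_slice_fst (hXd hxab)).deriv, ← (hasDerivAt_slice_snd (hXd hxab)).deriv,
      show x * (1 * deriv (fun D' => X i D' (ψ x)) x +
          -deriv (fun D' => N D' (ψ x)) x / deriv (N x) (ψ x) * deriv (X i x) (ψ x)) =
        (x * deriv (fun D' => X i D' (ψ x)) x * deriv (N x) (ψ x) -
          x * deriv (fun D' => N D' (ψ x)) x * deriv (X i x) (ψ x)) / deriv (N x) (ψ x) by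
        field_simp; ring,
      abs_div, div_le_iff₀ (abs_pos.2 hne)]
    exact hjac

end Summit.QuantumFields.YangMills.Cruxes.ContinuumLimitOnTrajectory.JacobianCollapseGronwall
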